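import Summits.ValiantsHypothesis.ValiantsHypothesis.Theorems.RigidityForcesSymmetryGrenetFirstOrderRankRigidPermSlices

/-!
# Route RigidityForcesSymmetry — `GrenetFirstOrderRankRigid` (item stmt-ValiantsHypothesis-21029),
line `grenet_gauge`: stub `stub_linearRigid`, step 5 (block II, design E1) — the block terms at the
permutation point `[C₀ | A | rest]`

For the crux line `Cruxes/GrenetFirstOrderRankRigid/Lines/grenet_gauge.lean` (blueprint
`Lines/grenet_gauge-stub_linearRigid-PROOF.md`, §5, block II; NOTES "TYPE II FORMAL PLAN").  Design E1
of the overlap block `(A, k₀)` (`u = |A| + k₀`) is the permutation point of a `π` with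
`π({c < k₀}) = C₀ ⊆ Aᶜ` and `π({k₀ ≤ c < u}) = A`; write `α_first = π(k₀)`, `α_last = π(u-1)`.  At this
point the cofactor term `per · W T S · x_v - W ∅ S · x_v · W T univ` of

* a tail entry `ρ[T, p]` (`S + p = A ⊔ T`, `v = (p, u-1)`) evaluates to `[p = α_last] - [p = α_last ∧ T = C₀]`
  (`blockII_perm_eval_tail`);
* a head entry `κ[C', p]` (`S = A ⊔ C'`, `T = C' + p`, `v = (p, k₀)`) evaluates to
  `[p = α_first] - [p = α_first ∧ C' = C₀]` (`blockII_perm_eval_head`).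

No new definitions.  VP ≠ VNP is not moved by this file.
-/

noncomputable section

open MvPolynomial Matrix Finset

namespace Summit.ValiantsHypothesis.Theorems.RigidityForcesSymmetry.GrenetGauge

open Literature.Computability.AlgebraicComplexity

variable (k : Type*) [CommRing k] {n : ℕ}

/-- The slices of the E1 permutation: `π({k₀ ≤ c < u-1}) = A - α_last`, `π({k₀+1 ≤ c < u}) = A - α_first`,
`π({c < u}) = C₀ ∪ A`, `π({c < u-1}) = C₀ ∪ (A - α_last)`, `π({c < k₀+1}) = C₀ + α_first`. [folklore] -/
theorem blockII_perm_slices (π : Equiv.Perm (Fin n)) (A : Finset (Fin n)) (hA : 0 < A.card) (k₀ : ℕ)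
    {u : ℕ} (huA : A.card + k₀ = u) (hu : u ≤ n) (hul : u - 1 < n) (hkn : k₀ < n)
    (hπA : (univ.filter fun c : Fin n => k₀ ≤ (c : ℕ) ∧ (c : ℕ) < u).image π = A) :
    (univ.filter fun c : Fin n => k₀ ≤ (c : ℕ) ∧ (c : ℕ) < u - 1).image π
        = A.erase (π ⟨u - 1, hul⟩) ∧
    (univ.filter fun c : Fin n => k₀ + 1 ≤ (c : ℕ) ∧ (c : ℕ) < u).image π
        = A.erase (π ⟨k₀, hkn⟩) ∧
    (univ.filter fun c : Fin n => (c : ℕ) < u).image π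
        = (univ.filter fun c : Fin n => (c : ℕ) < k₀).image π ∪ A ∧
    (univ.filter fun c : Fin n => (c : ℕ) < u - 1).image π
        = (univ.filter fun c : Fin n => (c : ℕ) < k₀).image π ∪ A.erase (π ⟨u - 1, hul⟩) ∧
    (univ.filter fun c : Fin n => (c : ℕ) < k₀ + 1).image π
        = insert (π ⟨k₀, hkn⟩) ((univ.filter fun c : Fin n => (c : ℕ) < k₀).image π) := by
  have h1 : (univ.filter fun c : Fin n => k₀ ≤ (c : ℕ) ∧ (c : ℕ) < u - 1).image π
      = A.erase (π ⟨u - 1, hul⟩) := by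
    have h := (permSlice_succ_right π (s := k₀) (t := u) (by omega) hu).symm.trans hπA
    rw [← h, Finset.erase_insert (perm_notMem_permSlice_of_ge π _ (by simp only; omega))]
  have h2 : (univ.filter fun c : Fin n => k₀ + 1 ≤ (c : ℕ) ∧ (c : ℕ) < u).image π
      = A.erase (π ⟨k₀, hkn⟩) := by
    have h := (permSlice_succ_left π (s := k₀) (t := u) (by omega) (by omega)).symm.trans hπA
    rw [← h, Finset.erase_insert (perm_notMem_permSlice_of_lt π _ (by simp only; omega))]
  refine ⟨h1, h2, ?_, ?_, ?_⟩
  · rw [← permSlice_zero, ← permSlice_union π (s := 0) (t := k₀) (r := u) (by omega) (by omega),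
      permSlice_zero, hπA]
  · rw [← permSlice_zero, ← permSlice_union π (s := 0) (t := k₀) (r := u - 1) (by omega) (by omega),
      permSlice_zero, h1]
  · rw [Grenet.prefix_image_succ π (by omega)]

/-- At a permutation point, `W T univ = [T is the prefix of its own length]`, in complement form:
`Disjoint T Pᶜ ∧ T ∪ Pᶜ = univ ↔ T = P`. [folklore] -/
theorem disjoint_compl_and_union_iff {T P : Finset (Fin n)} :
    (Disjoint T Pᶜ ∧ T ∪ Pᶜ = univ) ↔ T = P := by
  constructor
  · rintro ⟨h1, h2⟩
    apply Finset.Subset.antisymm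
    · intro x hx
      by_contra hxP
      exact Finset.disjoint_left.mp h1 hx (Finset.mem_compl.mpr hxP)
    · intro x hx
      have : x ∈ T ∪ Pᶜ := by rw [h2]; exact Finset.mem_univ x
      exact (Finset.mem_union.mp this).resolve_right (fun h => Finset.mem_compl.mp h hx)
  · rintro rfl
    exact ⟨disjoint_compl_right, Finset.union_compl T⟩

/-- The permanent is `1` at a permutation point. [folklore] -/
theorem evalPerm_perPoly (π : Equiv.Perm (Fin n)) :
    eval (fun w : Fin n × Fin n => if π w.2 = w.1 then (1 : k) else 0) (perPoly (Fin n) k) = 1 := by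
  rw [← grenet_W_empty_univ, evalPerm_grenet_W k π ∅ univ (by simp), if_pos]
  refine ⟨Finset.disjoint_empty_left _, ?_⟩
  rw [Finset.empty_union, Finset.card_empty, Finset.card_univ, Fintype.card_fin, permSlice_zero]
  exact Finset.eq_univ_of_forall fun x => (Grenet.mem_prefix_image π n x).mpr (π.symm x).isLt

/-- **E1, tail entries.**  At the permutation point of `π` (`π({c<k₀}) = C₀ ⊆ Aᶜ`, `π({k₀≤c<u}) = A`),
the cofactor term of a tail entry `ρ[T, p]` of the block `(A, k₀)` evaluates to
`[p = α_last] - [p = α_last ∧ T = C₀]`. [cite: Grenet2011, Thm. 1] -/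
theorem blockII_perm_eval_tail (π : Equiv.Perm (Fin n)) (A : Finset (Fin n)) (hA : 0 < A.card) (k₀ : ℕ)
    {u : ℕ} (huA : A.card + k₀ = u) (hu : u ≤ n) (hul : u - 1 < n) (hkn : k₀ < n)
    (hπC : (univ.filter fun c : Fin n => (c : ℕ) < k₀).image π ⊆ Aᶜ)
    (hπA : (univ.filter fun c : Fin n => k₀ ≤ (c : ℕ) ∧ (c : ℕ) < u).image π = A)
    (S T : Finset (Fin n)) (v : Fin n × Fin n) (ht : v.1 ∉ S ∧ (v.2 : ℕ) = S.card) (hTsub : T ⊆ Aᶜ)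
    (hTk : T.card = k₀) (hUS : insert v.1 S = A ∪ T) (hq : (v.2 : ℕ) = u - 1) :
    eval (fun w : Fin n × Fin n => if π w.2 = w.1 then (1 : k) else 0)
        (perPoly (Fin n) k * (1 - Grenet.adj k n).adjugate T S * X v
          - (1 - Grenet.adj k n).adjugate ∅ S * X v * (1 - Grenet.adj k n).adjugate T univ)
      = (if v.1 = π ⟨u - 1, hul⟩ then 1 else 0)
        - (if v.1 = π ⟨u - 1, hul⟩ ∧ T = (univ.filter fun c : Fin n => (c : ℕ) < k₀).image π
            then 1 else 0) := by
  obtain ⟨hs1, -, -, hs4, -⟩ := blockII_perm_slices π A hA k₀ huA hu hul hkn hπA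
  set αl := π ⟨u - 1, hul⟩ with hαl
  set C₀ := (univ.filter fun c : Fin n => (c : ℕ) < k₀).image π with hC₀
  have hdisjT : Disjoint A T := Finset.disjoint_left.mpr fun x hxA hxT => (Finset.mem_compl.mp (hTsub hxT)) hxA
  have hdisj0 : Disjoint A C₀ := Finset.disjoint_left.mpr fun x hxA hx0 => (Finset.mem_compl.mp (hπC hx0)) hxA
  have hScard : S.card = u - 1 := by rw [← ht.2, hq]
  have hSeq : S = (A ∪ T).erase v.1 := by rw [← hUS, Finset.erase_insert ht.1]
  have hαlA : αl ∈ A := by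
    rw [← hπA]; exact Finset.mem_image_of_mem _ (by simp only [Finset.mem_filter, Finset.mem_univ, true_and]; omega)
  have hαlT : αl ∉ T := fun h => Finset.disjoint_left.mp hdisjT hαlA h
  have hαl0 : αl ∉ C₀ := fun h => Finset.disjoint_left.mp hdisj0 hαlA h
  have hv2 : v.2 = ⟨u - 1, hul⟩ := Fin.ext hq
  have hvAT : v.1 ∈ A ∪ T := by rw [← hUS]; exact Finset.mem_insert_self _ _
  -- `(A ∪ T) - αl = T ∪ (A - αl)`
  have hF1 : (A ∪ T).erase αl = T ∪ A.erase αl := by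
    ext x
    simp only [Finset.mem_erase, Finset.mem_union, ne_eq]
    constructor
    · rintro ⟨hne, hA' | hT'⟩
      · exact Or.inr ⟨hne, hA'⟩
      · exact Or.inl hT'
    · rintro (hT' | ⟨hne, hA'⟩)
      · exact ⟨fun h => hαlT (h ▸ hT'), Or.inr hT'⟩
      · exact ⟨hne, Or.inl hA'⟩
  -- `S = T ∪ (A - αl)` forces `p = αl`
  have hF2 : T ∪ A.erase αl = S → v.1 = αl := by
    intro h
    by_contra hp
    have : αl ∈ S := by rw [hSeq]; exact Finset.mem_erase.mpr ⟨fun h' => hp h'.symm, Finset.mem_union.mpr (Or.inl hαlA)⟩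
    rw [← h, Finset.mem_union] at this
    exact this.elim hαlT (Finset.notMem_erase _ _)
  -- the four evaluations
  have eX : eval (fun w : Fin n × Fin n => if π w.2 = w.1 then (1 : k) else 0) (X v)
      = if v.1 = αl then 1 else 0 := by
    rw [eval_X, hv2]
    by_cases h : v.1 = αl
    · rw [if_pos h, if_pos (by rw [h])]
    · rw [if_neg h, if_neg (fun h' => h (by rw [← h']))]
  have eTS : eval (fun w : Fin n × Fin n => if π w.2 = w.1 then (1 : k) else 0) ((1 - Grenet.adj k n).adjugate T S)
      = if v.1 = αl then 1 else 0 := by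
    rw [evalPerm_grenet_W k π T S (by rw [hTk, hScard]; omega), hTk, hScard, hs1]
    by_cases hp : v.1 = αl
    · rw [if_pos hp, if_pos]
      refine ⟨Finset.disjoint_of_subset_right (Finset.erase_subset _ _) hdisjT.symm, ?_⟩
      rw [hSeq, hp, hF1]
    · rw [if_neg hp, if_neg (fun h => hp (hF2 h.2))]
  have hF3 : C₀ ∪ A.erase αl = S → v.1 = αl := by
    intro h
    by_contra hp
    have : αl ∈ S := by rw [hSeq]; exact Finset.mem_erase.mpr ⟨fun h' => hp h'.symm, Finset.mem_union.mpr (Or.inl hαlA)⟩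
    rw [← h, Finset.mem_union] at this
    exact this.elim hαl0 (Finset.notMem_erase _ _)
  -- sets outside `A` are determined by their union with a subset of `A`
  have hcancel : ∀ X Y : Finset (Fin n), X ⊆ Aᶜ → Y ⊆ Aᶜ → X ∪ A.erase αl = Y ∪ A.erase αl → X = Y := by
    intro X Y hX hY h
    ext x
    constructor
    · intro hx
      have : x ∈ Y ∪ A.erase αl := by rw [← h]; exact Finset.mem_union.mpr (Or.inl hx)
      exact (Finset.mem_union.mp this).resolve_right fun h' => Finset.mem_compl.mp (hX hx) (Finset.mem_of_mem_erase h')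
    · intro hx
      have : x ∈ X ∪ A.erase αl := by rw [h]; exact Finset.mem_union.mpr (Or.inl hx)
      exact (Finset.mem_union.mp this).resolve_right fun h' => Finset.mem_compl.mp (hY hx) (Finset.mem_of_mem_erase h')
  have e0S : eval (fun w : Fin n × Fin n => if π w.2 = w.1 then (1 : k) else 0) ((1 - Grenet.adj k n).adjugate ∅ S)
      = if v.1 = αl ∧ T = C₀ then 1 else 0 := by
    rw [evalPerm_grenet_W k π ∅ S (by simp), Finset.card_empty, hScard, permSlice_zero, hs4, Finset.empty_union]
    simp only [Finset.disjoint_empty_left, true_and]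
    by_cases hp : v.1 = αl ∧ T = C₀
    · rw [if_pos hp, if_pos]; rw [hSeq, hp.1, hF1, hp.2, Finset.union_comm]
    · rw [if_neg hp, if_neg]
      intro h
      have hp1 : v.1 = αl := hF3 h
      refine hp ⟨hp1, (hcancel C₀ T hπC hTsub ?_).symm⟩
      rw [h, hSeq, hp1, hF1, Finset.union_comm]
  have eTU : eval (fun w : Fin n × Fin n => if π w.2 = w.1 then (1 : k) else 0) ((1 - Grenet.adj k n).adjugate T univ)
      = if T = C₀ then 1 else 0 := by
    rw [evalPerm_grenet_W k π T univ (by rw [Finset.card_univ]; exact Finset.card_le_univ T), hTk, Finset.card_univ,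
      Fintype.card_fin, permSlice_to_top]
    by_cases hT : T = C₀
    · rw [if_pos hT, if_pos (disjoint_compl_and_union_iff.mpr hT)]
    · rw [if_neg hT, if_neg (fun h => hT (disjoint_compl_and_union_iff.mp h))]
  rw [map_sub, map_mul, map_mul, map_mul, map_mul, evalPerm_perPoly, eTS, eX, e0S, eTU]
  by_cases hp : v.1 = αl <;> by_cases hT : T = C₀ <;> simp [hp, hT]

/-- **E1, head entries.**  At the same point, the cofactor term of a head entry `κ[C', p]` of the block
`(A, k₀)` (`S = A ⊔ C'`, `T = C' + p`, `v = (p, k₀)`) evaluates to `[p = α_first] - [p = α_first ∧ C' = C₀]`.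
[cite: Grenet2011, Thm. 1] -/
theorem blockII_perm_eval_head (π : Equiv.Perm (Fin n)) (A : Finset (Fin n)) (hA : 0 < A.card) (k₀ : ℕ)
    {u : ℕ} (huA : A.card + k₀ = u) (hu : u ≤ n) (hul : u - 1 < n) (hkn : k₀ < n)
    (hπC : (univ.filter fun c : Fin n => (c : ℕ) < k₀).image π ⊆ Aᶜ)
    (hπA : (univ.filter fun c : Fin n => k₀ ≤ (c : ℕ) ∧ (c : ℕ) < u).image π = A)
    (S T : Finset (Fin n)) (v : Fin n × Fin n) (hh : v.1 ∈ T ∧ T.card = (v.2 : ℕ) + 1)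
    (hCsub : T.erase v.1 ⊆ Aᶜ) (hCk : (T.erase v.1).card = k₀) (hS : S = A ∪ T.erase v.1)
    (hq : (v.2 : ℕ) = k₀) :
    eval (fun w : Fin n × Fin n => if π w.2 = w.1 then (1 : k) else 0)
        (perPoly (Fin n) k * (1 - Grenet.adj k n).adjugate T S * X v
          - (1 - Grenet.adj k n).adjugate ∅ S * X v * (1 - Grenet.adj k n).adjugate T univ)
      = (if v.1 = π ⟨k₀, hkn⟩ then 1 else 0)
        - (if v.1 = π ⟨k₀, hkn⟩ ∧ T.erase v.1 = (univ.filter fun c : Fin n => (c : ℕ) < k₀).image π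
            then 1 else 0) := by
  obtain ⟨-, hs2, hs3, -, hs5⟩ := blockII_perm_slices π A hA k₀ huA hu hul hkn hπA
  set αf := π ⟨k₀, hkn⟩ with hαf
  set C₀ := (univ.filter fun c : Fin n => (c : ℕ) < k₀).image π with hC₀
  set C' := T.erase v.1 with hC'
  have hdisjC : Disjoint A C' := Finset.disjoint_left.mpr fun x hxA hx => (Finset.mem_compl.mp (hCsub hx)) hxA
  have hdisj0 : Disjoint A C₀ := Finset.disjoint_left.mpr fun x hxA hx0 => (Finset.mem_compl.mp (hπC hx0)) hxA
  have hTins : T = insert v.1 C' := by rw [hC', Finset.insert_erase hh.1]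
  have hTcard : T.card = k₀ + 1 := by rw [hh.2, hq]
  have hScard : S.card = u := by rw [hS, Finset.card_union_of_disjoint hdisjC, hCk, huA]
  have hαfA : αf ∈ A := by
    rw [← hπA]; exact Finset.mem_image_of_mem _ (by simp only [Finset.mem_filter, Finset.mem_univ, true_and]; omega)
  have hαfC : αf ∉ C' := fun h => Finset.disjoint_left.mp hdisjC hαfA h
  have hv2 : v.2 = ⟨k₀, hkn⟩ := Fin.ext hq
  have hpC : v.1 ∉ C' := by rw [hC']; exact Finset.notMem_erase _ _
  have hcancel : ∀ X Y : Finset (Fin n), Disjoint A X → Disjoint A Y → A ∪ X = A ∪ Y → X = Y := by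
    intro X Y hX hY h
    ext x
    constructor
    · intro hx
      have : x ∈ A ∪ Y := by rw [← h]; exact Finset.mem_union.mpr (Or.inr hx)
      exact (Finset.mem_union.mp this).resolve_left fun h' => Finset.disjoint_left.mp hX h' hx
    · intro hx
      have : x ∈ A ∪ X := by rw [h]; exact Finset.mem_union.mpr (Or.inr hx)
      exact (Finset.mem_union.mp this).resolve_left fun h' => Finset.disjoint_left.mp hY h' hx
  -- the four evaluations
  have eX : eval (fun w : Fin n × Fin n => if π w.2 = w.1 then (1 : k) else 0) (X v)
      = if v.1 = αf then 1 else 0 := by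
    rw [eval_X, hv2]
    by_cases h : v.1 = αf
    · rw [if_pos h, if_pos (by rw [h])]
    · rw [if_neg h, if_neg (fun h' => h (by rw [← h']))]
  have eTS : eval (fun w : Fin n × Fin n => if π w.2 = w.1 then (1 : k) else 0) ((1 - Grenet.adj k n).adjugate T S)
      = if v.1 = αf then 1 else 0 := by
    rw [evalPerm_grenet_W k π T S (by rw [hTcard, hScard]; omega), hTcard, hScard, hs2]
    by_cases hp : v.1 = αf
    · rw [if_pos hp, if_pos]
      constructor
      · rw [hTins, hp, Finset.disjoint_insert_left]
        exact ⟨Finset.notMem_erase _ _, Finset.disjoint_of_subset_right (Finset.erase_subset _ _) hdisjC.symm⟩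
      · rw [hTins, hp, hS, Finset.insert_union, ← Finset.union_insert, Finset.insert_erase hαfA, Finset.union_comm]
    · rw [if_neg hp, if_neg]
      rintro ⟨-, h⟩
      apply hp
      have : αf ∈ T ∪ A.erase αf := by rw [h, hS]; exact Finset.mem_union.mpr (Or.inl hαfA)
      rcases Finset.mem_union.mp this with h' | h'
      · rw [hTins, Finset.mem_insert] at h'
        exact (h'.resolve_right hαfC).symm
      · exact absurd h' (Finset.notMem_erase _ _)
  have e0S : eval (fun w : Fin n × Fin n => if π w.2 = w.1 then (1 : k) else 0) ((1 - Grenet.adj k n).adjugate ∅ S)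
      = if C' = C₀ then 1 else 0 := by
    rw [evalPerm_grenet_W k π ∅ S (by simp), Finset.card_empty, hScard, permSlice_zero, hs3, Finset.empty_union]
    simp only [Finset.disjoint_empty_left, true_and]
    by_cases hc : C' = C₀
    · rw [if_pos hc, if_pos]; rw [hS, hc, Finset.union_comm]
    · rw [if_neg hc, if_neg]
      intro h
      exact hc (hcancel C' C₀ hdisjC hdisj0 (by rw [← hS, ← h, Finset.union_comm]))
  have eTU : eval (fun w : Fin n × Fin n => if π w.2 = w.1 then (1 : k) else 0) ((1 - Grenet.adj k n).adjugate T univ)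
      = if T = insert αf C₀ then 1 else 0 := by
    rw [evalPerm_grenet_W k π T univ (by rw [Finset.card_univ]; exact Finset.card_le_univ T), hTcard, Finset.card_univ,
      Fintype.card_fin, permSlice_to_top, hs5]
    by_cases hT : T = insert αf C₀
    · rw [if_pos hT, if_pos (disjoint_compl_and_union_iff.mpr hT)]
    · rw [if_neg hT, if_neg (fun h => hT (disjoint_compl_and_union_iff.mp h))]
  rw [map_sub, map_mul, map_mul, map_mul, map_mul, evalPerm_perPoly, eTS, eX, e0S, eTU]
  by_cases hp : v.1 = αf <;> by_cases hc : C' = C₀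
  · have hT : T = insert αf C₀ := by rw [hTins, hp, hc]
    simp [hp, hc, hT]
  · simp [hp, hc]
  · simp [hp, hc]
  · simp [hp, hc]

end Summit.ValiantsHypothesis.Theorems.RigidityForcesSymmetry.GrenetGauge
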